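import Literature.AlgebraicGeometry.Motives.AimedSplitProductProofs
import Literature.AlgebraicGeometry.Motives.HyperbolicWeilTypeProduct
import Literature.AlgebraicGeometry.Motives.RationalDegreeOneModel
import Literature.AlgebraicGeometry.Motives.AbelianVarietyCohomologyExteriorH1
import Literature.AlgebraicGeometry.HodgeTheory.ComplexGysinHodgeType
import Literature.AlgebraicGeometry.HodgeTheory.HodgeTypeConjugation
import Literature.AlgebraicGeometry.HodgeTheory.HodgeTypePullback
import Literature.AlgebraicGeometry.HodgeTheory.CupPreservesHodgeTypeOfDeRham
import Literature.AlgebraicGeometry.HodgeTheory.ComplexConjugationHolds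
import Literature.AlgebraicGeometry.HodgeTheory.HodgeFiltrationModelsReductionProofs
import Literature.NumberTheory.Transcendental.DeRhamTheoremMultiplicative
import HarnessLib

/-!
# A rational `(2,2)`-class in the single-test "Weil span" of a `√-3`-fourfold of type `(3,1)`/`(1,3)`

Layer `Literature/AlgebraicGeometry/Motives`, companion of `Motives/AimedSplitProduct`, whose module
docstring (`## Misstatement`) explains why the named fact `exists_cmWeilSurface_aimedSplitProduct` is
false at `d = 3`: the single test endomorphism `(𝟙 + φ)^*` on `H⁴(A(ℂ); ℂ)` has the eigenvalue
collision `(1 + i√3)(1 - i√3)³ = (1 + i√3)⁴` (`weilTestCharacter_collision_three`), so its two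
eigenspaces for `(1 ± i√3)⁴` are LARGER than the Weil lines, and contain non-zero rational
`(2,2)`-classes on abelian fourfolds which are NOT of Weil type. This file CONSTRUCTS such a class, on
the tree's real carriers and for an arbitrary complex elliptic curve `E` (`E.dim = 1`) with an
endomorphism `r`, `r ≫ r = -3` (supplied by `HodgeTheory/EisensteinCurveSqrtMinusThree`:
`E = E_ω`, `r = [√-3]`):

* the fourfold `A = (E × (E × E)) × E` with `φ_r = (r × (r × -r)) × r` (`fourfold`, `phiOf`), so that
  `φ_r ≫ φ_r = -3` (`phiOf_comp_phiOf`) and `-φ_r = φ_{-r}` (`neg_phiOf`) — the `K`-multiplicities of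
  `(A, φ_r)` on `H^{1,0}` are `(3, 1)` or `(1, 3)`, never `(2, 2)`;
* the class `c = pr_{123}^*(pr₁^* π ⌣ pr₂₃^* δ) ∈ H⁴(A(ℂ); ℂ)`, where `π ∈ H²(E(ℂ); ℂ)` is rational and
  non-zero and `δ = m^*π - pr₁^*π - pr₂^*π ∈ H²((E × E)(ℂ); ℂ)` (`m = pr₁ + pr₂` the group law) is the
  rational `(1,1)`-class `κ·(pr₁^*v₊ ⌣ pr₂^*v₋ - pr₁^*v₋ ⌣ pr₂^*v₊)` (`v± ∈ H¹(E(ℂ); ℂ)` the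
  `± i√3`-eigenvectors of `r^*`) — the Künneth component of type `H¹ ⊗ H¹` of the class of the
  (anti)diagonal;
* **`exists_singleTest_weilSpan_class`**: `c ≠ 0`, `c` is rational, of Hodge type `(2, 2)`, and
  `c ∈ Eig((𝟙 + φ_r)^*, (1 + i√3)⁴) ⊔ Eig((𝟙 + φ_r)^*, (1 - i√3)⁴)` — verbatim the hypothesis of the
  inner `∀` of `exists_cmWeilSurface_aimedSplitProduct` at `d = 3`, `n = 2`; indeed
  `(𝟙 + φ_r)^*` multiplies `pr^*π ⌣ pr^*(pr₁^*v₊ ⌣ pr₂^*v₋)` by `4(1 + i√3)² = (1 - i√3)⁴` and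
  `pr^*π ⌣ pr^*(pr₁^*v₋ ⌣ pr₂^*v₊)` by `4(1 - i√3)² = (1 + i√3)⁴`.

Ingredients, all theorems of the tree: additivity of `f ↦ f^*|_{H¹}` and `H¹ = V₊ ⊕ V₋` with
`dim V± = 1` (`AbelianVarietyEndomorphismsHOne`), `H² = ⋀²H¹` for a curve
(`abelianVarietyCohomologyExteriorH1_holds`), rational classes span (`RationalDegreeOneModel`),
Künneth non-vanishing `pr₁^*x ⌣ pr₂^*y ≠ 0` (`AimedSplitProductProofs`), Hodge types of pull-backs
and cup products (`HodgeTypePullback`, `CupPreservesHodgeTypeOfDeRham` with de Rham's theorem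
`exists_deRhamIsoFamily_holds`, `nonempty_hodgeModel_holds`, `hodgePQ_independent_of_hodgeModel_holds`)
and "top-degree classes are of type `(n, n)`" (`hodgePQ_two_mul_finrank_eq_top`). Everything is
proved; no definition of a carrier and no named fact is introduced (D-0026).

## References

* [vanGeemen1994HodgeAV] B. van Geemen, An introduction to the Hodge conjecture for abelian
  varieties, LNM 1594 (1994), 4.9, Lemma 5.2 (6) and its proof (the Weil lines `⋀^{2n}V±`).
* [LangeBirkenhake1992] H. Lange, Ch. Birkenhake, Complex Abelian Varieties (1992), Prop. 1.1.9,
  Lemma 1.1.17.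
* [HatcherAT2002] A. Hatcher, Algebraic Topology (2002), Prop. 3.10, Thm. 3.11, Thm. 3.15.
-/

noncomputable section

open CategoryTheory
open Literature.AlgebraicGeometry Literature.AlgebraicGeometry.HodgeTheory
open Literature.AlgebraicTopology.SingularHomology

namespace Literature.AlgebraicGeometry.Motives

namespace EisensteinCounterexample

/-! ### Small generalities -/

/-- Rational classes are stable under negation. [cite: HatcherAT2002, §3.1] -/
theorem isRationalClass_neg {Y : Type} [TopologicalSpace Y] {k : ℕ} {c : singularCohomology ℂ ℂ Y k}
    (hc : IsRationalClass c) : IsRationalClass (-c) := by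
  have h := hc.smul (-1)
  rwa [show ((-1 : ℚ) : ℂ) • c = -c by simp] at h

/-- Rational classes are stable under subtraction. [cite: HatcherAT2002, §3.1] -/
theorem isRationalClass_sub {Y : Type} [TopologicalSpace Y] {k : ℕ} {c c' : singularCohomology ℂ ℂ Y k}
    (hc : IsRationalClass c) (hc' : IsRationalClass c') : IsRationalClass (c - c') := by
  rw [sub_eq_add_neg]; exact hc.add (isRationalClass_neg hc')

/-- Pull-back along a homomorphism of abelian varieties preserves rationality. [cite: HatcherAT2002, §3.1] -/
theorem isRationalClass_map {X Y : AbelianVariety ℂ} (f : X ⟶ Y) {k : ℕ} {c : complexBetti Y.X k}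
    (hc : IsRationalClass c) : IsRationalClass (complexBetti.map f.hom.hom.hom k c) :=
  hc.pullback _

/-- Pull-back along a homomorphism is multiplicative: `f^*(a ⌣ b) = f^*a ⌣ f^*b`. [cite: HatcherAT2002, Prop. 3.10] -/
theorem map_cupProduct {X Y : AbelianVariety ℂ} (f : X ⟶ Y) {p q m : ℕ} (h : p + q = m)
    (a : complexBetti Y.X p) (b : complexBetti Y.X q) :
    complexBetti.map f.hom.hom.hom m (cupProduct h a b) =
      cupProduct h (complexBetti.map f.hom.hom.hom p a) (complexBetti.map f.hom.hom.hom q b) :=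
  cupProduct_map _ h a b

/-- **Every top-degree class is of Hodge type `(n, n)`** (in any Hodge model the unit circle acts
trivially on top-degree forms, `hodgePQ_two_mul_finrank_eq_top`). [cite: VoisinHodgeI2002, Cor. 6.14] -/
theorem isOfHodgeType_top {n : ℕ} {X : SchemeOver ℂ} (M : HodgeModel n X) (c : complexBetti X (2 * n)) :
    IsOfHodgeType n X (2 * n) n n c := by
  refine ⟨M, ?_⟩
  have htop : Literature.NumberTheory.Transcendental.hodgePQ M.model M.carrier (2 * n) n n = ⊤ :=
    hodgePQ_two_mul_finrank_eq_top (M := M.carrier) M.isAnalytification.finrank_eq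
  change M.pullback (2 * n) c ∈
    (Literature.NumberTheory.Transcendental.hodgePQ M.model M.carrier (2 * n) n n).map
      (M.deRham M.carrier (2 * n)).toLinearMap
  rw [htop, Submodule.map_top, LinearEquiv.range]
  exact Submodule.mem_top

/-- The two collision identities at `d = 3`: `4(1 + i√3)² = (1 - i√3)⁴`. [folklore] -/
theorem four_mul_one_add_sq :
    (4 : ℂ) * (1 + Complex.I * (Real.sqrt ((3 : ℕ) : ℝ) : ℂ)) ^ 2 =
      (1 - Complex.I * (Real.sqrt ((3 : ℕ) : ℝ) : ℂ)) ^ 4 := by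
  have hs : (Complex.I * (Real.sqrt ((3 : ℕ) : ℝ) : ℂ)) ^ 2 = -3 := by rw [I_mul_sqrt_sq 3]; norm_num
  linear_combination (-(Complex.I * (Real.sqrt ((3 : ℕ) : ℝ) : ℂ)) ^ 2 +
    4 * (Complex.I * (Real.sqrt ((3 : ℕ) : ℝ) : ℂ)) + 1) * hs

/-- … and `4(1 - i√3)² = (1 + i√3)⁴`. [folklore] -/
theorem four_mul_one_sub_sq :
    (4 : ℂ) * (1 - Complex.I * (Real.sqrt ((3 : ℕ) : ℝ) : ℂ)) ^ 2 =
      (1 + Complex.I * (Real.sqrt ((3 : ℕ) : ℝ) : ℂ)) ^ 4 := by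
  have hs : (Complex.I * (Real.sqrt ((3 : ℕ) : ℝ) : ℂ)) ^ 2 = -3 := by rw [I_mul_sqrt_sq 3]; norm_num
  linear_combination (-(Complex.I * (Real.sqrt ((3 : ℕ) : ℝ) : ℂ)) ^ 2 -
    4 * (Complex.I * (Real.sqrt ((3 : ℕ) : ℝ) : ℂ)) + 1) * hs

/-! ### Degree one and two on the elliptic curve `(E, r)`, `r ≫ r = -3` -/

section Curve

variable {E : AbelianVariety ℂ}

/-- Shorthand: `s = i√3`. [folklore] -/
local notation "𝕤" => (Complex.I * ((Real.sqrt ((3 : ℕ) : ℝ) : ℝ) : ℂ))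

/-- `(𝟙 + r)^* v = (1 + μ) v` for an eigenvector `v` of `r^*` on `H¹`. [cite: LangeBirkenhake1992, §1.1 p. 19] -/
theorem map_id_add_one_of_mem_eigenspace {r : E ⟶ E} {μ : ℂ} {v : complexBetti E.X 1}
    (hv : v ∈ Module.End.eigenspace (complexBetti.map r.hom.hom.hom 1).hom μ) :
    complexBetti.map (𝟙 E + r).hom.hom.hom 1 v = (1 + μ) • v := by
  have h := complexBetti_map_nsmul_id_add_nsmul_one_of_mem_eigenspace hv 1 1
  simp only [one_smul, Nat.cast_one, one_mul] at h
  exact h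

/-- `(𝟙 - r)^* v = (1 - μ) v` for an eigenvector `v` of `r^*` on `H¹`. [cite: LangeBirkenhake1992, §1.1 p. 19] -/
theorem map_id_sub_one_of_mem_eigenspace {r : E ⟶ E} {μ : ℂ} {v : complexBetti E.X 1}
    (hv : v ∈ Module.End.eigenspace (complexBetti.map r.hom.hom.hom 1).hom μ) :
    complexBetti.map (𝟙 E - r).hom.hom.hom 1 v = (1 - μ) • v := by
  have h := complexBetti_map_zsmul_id_add_zsmul_one r 1 (-1) v
  rw [Module.End.mem_eigenspace_iff] at hv
  change _ = _ + _ • (complexBetti.map r.hom.hom.hom 1).hom v at h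
  rw [hv, one_zsmul, neg_one_zsmul, ← sub_eq_add_neg] at h
  rw [h, smul_smul, ← add_smul]
  congr 1
  push_cast
  ring

variable (hE : E.dim = 1) {r : E ⟶ E} (hr : r ≫ r = -((3 : ℕ) • 𝟙 E))
include hE hr

/-- **The eigenline decomposition of `H¹(E(ℂ); ℂ)`** for an elliptic curve with `r ≫ r = -3`: there
are non-zero `v₊ ∈ Eig(r^*, i√3)`, `v₋ ∈ Eig(r^*, -i√3)` spanning `H¹` (`dim H¹ = 2`,
`dim V₊ = dim V₋`, `V₊ ⊕ V₋ = H¹`). [cite: LangeBirkenhake1992, Prop. 1.1.9 and Lemma 1.1.17] -/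
theorem exists_eigenvectors_one :
    ∃ vp vm : complexBetti E.X 1, vp ≠ 0 ∧ vm ≠ 0 ∧
      vp ∈ Module.End.eigenspace (complexBetti.map r.hom.hom.hom 1).hom 𝕤 ∧
      vm ∈ Module.End.eigenspace (complexBetti.map r.hom.hom.hom 1).hom (-𝕤) ∧
      ∀ a : complexBetti E.X 1, ∃ α β : ℂ, a = α • vp + β • vm := by
  haveI := finite_complexBetti_abelianVariety E 1
  have hd : (0 : ℕ) < 3 := by norm_num
  have h2 : Module.finrank ℂ (complexBetti E.X 1) = 2 := by
    rw [AbelianVariety.finrank_complexBetti_one, hE]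
  have hVp : Module.finrank ℂ (Module.End.eigenspace (complexBetti.map r.hom.hom.hom 1).hom 𝕤) = 1 := by
    have h := two_mul_finrank_eigenspace_eq hd hr
    rw [h2] at h
    omega
  have hVm : Module.finrank ℂ (Module.End.eigenspace (complexBetti.map r.hom.hom.hom 1).hom (-𝕤)) = 1 := by
    rw [← finrank_eigenspace_eq_finrank_eigenspace_neg hd hr, hVp]
  have hVp_ne : Module.End.eigenspace (complexBetti.map r.hom.hom.hom 1).hom 𝕤 ≠ ⊥ := by
    intro hbot; rw [hbot, finrank_bot] at hVp; exact zero_ne_one hVp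
  have hVm_ne : Module.End.eigenspace (complexBetti.map r.hom.hom.hom 1).hom (-𝕤) ≠ ⊥ := by
    intro hbot; rw [hbot, finrank_bot] at hVm; exact zero_ne_one hVm
  obtain ⟨vp, hvpmem, hvp0⟩ := Submodule.exists_mem_ne_zero_of_ne_bot hVp_ne
  obtain ⟨vm, hvmmem, hvm0⟩ := Submodule.exists_mem_ne_zero_of_ne_bot hVm_ne
  refine ⟨vp, vm, hvp0, hvm0, hvpmem, hvmmem, fun a => ?_⟩
  -- every line through a non-zero vector of a one-dimensional space is the whole space
  have hlp : ∀ x ∈ Module.End.eigenspace (complexBetti.map r.hom.hom.hom 1).hom 𝕤, ∃ α : ℂ, x = α • vp := by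
    intro x hx
    have h1 := (finrank_eq_one_iff_of_nonzero' (⟨vp, hvpmem⟩ : Module.End.eigenspace _ 𝕤)
      (by simpa using hvp0)).mp hVp ⟨x, hx⟩
    obtain ⟨α, hα⟩ := h1
    exact ⟨α, by simpa using (congrArg Subtype.val hα).symm⟩
  have hlm : ∀ x ∈ Module.End.eigenspace (complexBetti.map r.hom.hom.hom 1).hom (-𝕤), ∃ β : ℂ, x = β • vm := by
    intro x hx
    have h1 := (finrank_eq_one_iff_of_nonzero' (⟨vm, hvmmem⟩ : Module.End.eigenspace _ (-𝕤))
      (by simpa using hvm0)).mp hVm ⟨x, hx⟩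
    obtain ⟨β, hβ⟩ := h1
    exact ⟨β, by simpa using (congrArg Subtype.val hβ).symm⟩
  have htop := eigenspace_sup_eigenspace_neg_eq_top hd hr
  have ha : a ∈ Module.End.eigenspace (complexBetti.map r.hom.hom.hom 1).hom 𝕤 ⊔
      Module.End.eigenspace (complexBetti.map r.hom.hom.hom 1).hom (-𝕤) := by
    rw [htop]; exact Submodule.mem_top
  obtain ⟨x, hx, y, hy, rfl⟩ := Submodule.mem_sup.mp ha
  obtain ⟨α, rfl⟩ := hlp x hx
  obtain ⟨β, rfl⟩ := hlm y hy
  exact ⟨α, β, rfl⟩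

omit hE hr in
/-- Expansion of a cup product of degree-one classes in the eigenbasis:
`(αv₊ + βv₋) ⌣ (α'v₊ + β'v₋) = (αβ' - βα')·(v₊ ⌣ v₋)` (`v ⌣ v = 0`, `v₋ ⌣ v₊ = -v₊ ⌣ v₋`).
[cite: HatcherAT2002, Thm. 3.11] -/
theorem cupProduct_expand (vp vm : complexBetti E.X 1) (α β α' β' : ℂ) :
    cupProduct (rfl : 1 + 1 = 2) (α • vp + β • vm) (α' • vp + β' • vm) =
      (α * β' - β * α') • cupProduct (rfl : 1 + 1 = 2) vp vm := by
  have hpp : cupProduct (rfl : 1 + 1 = 2) vp vp = 0 := cup_self_deg_one vp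
  have hmm : cupProduct (rfl : 1 + 1 = 2) vm vm = 0 := cup_self_deg_one vm
  have hmp : cupProduct (rfl : 1 + 1 = 2) vm vp = -cupProduct (rfl : 1 + 1 = 2) vp vm := by
    have h := cupProduct_gradedComm_holds ℂ (ComplexPoints E.X) (rfl : 1 + 1 = 2) rfl vm vp
    simpa using h
  simp only [map_add, map_smul, LinearMap.add_apply, LinearMap.smul_apply, hpp, hmm, hmp, smul_zero,
    add_zero, zero_add, smul_neg, smul_smul]
  module

/-- **`H²(E(ℂ); ℂ) = ℂ · (v₊ ⌣ v₋)` with `v₊ ⌣ v₋ ≠ 0`** (`H² = ⋀²H¹` for the curve `E`,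
`abelianVarietyCohomologyExteriorH1_holds`; `dim H² = 1`). [cite: LangeBirkenhake1992, Lemma 1.1.17] -/
theorem exists_eigenvectors_two :
    ∃ vp vm : complexBetti E.X 1, vp ≠ 0 ∧ vm ≠ 0 ∧
      vp ∈ Module.End.eigenspace (complexBetti.map r.hom.hom.hom 1).hom 𝕤 ∧
      vm ∈ Module.End.eigenspace (complexBetti.map r.hom.hom.hom 1).hom (-𝕤) ∧
      cupProduct (rfl : 1 + 1 = 2) vp vm ≠ 0 ∧
      ∀ x : complexBetti E.X 2, ∃ κ : ℂ, x = κ • cupProduct (rfl : 1 + 1 = 2) vp vm := by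
  obtain ⟨vp, vm, hvp0, hvm0, hvp, hvm, hspan⟩ := exists_eigenvectors_one hE hr
  have hfact := abelianVarietyCohomologyExteriorH1_holds
  -- `dim H²(E) = 1`
  have h1 : Module.finrank ℂ (complexBetti E.X 2) = 1 := by
    have h := hfact.finrank_top E
    rw [hE] at h
    exact h
  haveI : Module.Finite ℂ (complexBetti E.X 2) := hfact.finite E 2
  -- every class of `H²` is a combination of products `a ⌣ b`, which are multiples of `v₊ ⌣ v₋`
  set w := cupProduct (rfl : 1 + 1 = 2) vp vm with hw
  have hmul : ∀ a b : complexBetti E.X 1, ∃ t : ℂ, cupProduct (rfl : 1 + 1 = 2) a b = t • w := by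
    intro a b
    obtain ⟨α, β, rfl⟩ := hspan a
    obtain ⟨α', β', rfl⟩ := hspan b
    exact ⟨α * β' - β * α', cupProduct_expand vp vm α β α' β'⟩
  have hle : (⊤ : Submodule ℂ (complexBetti E.X 2)) ≤ Submodule.span ℂ {w} := by
    rw [← hfact.span_range_cupPowOne E 2, Submodule.span_le]
    rintro _ ⟨u, rfl⟩
    have hu : cupPowOne ℂ (ComplexPoints E.X) 2 u = cupProduct (rfl : 1 + 1 = 2) (u 0) (u 1) := by
      rw [cupPowOne_succ]
      change cupProduct _ (u 0) (cupPowOne ℂ (ComplexPoints E.X) 1 (Fin.tail u)) = _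
      rw [cupPowOne_one]
      rfl
    obtain ⟨t, ht⟩ := hmul (u 0) (u 1)
    rw [SetLike.mem_coe, hu, ht]
    exact Submodule.smul_mem _ t (Submodule.mem_span_singleton_self w)
  have hw0 : w ≠ 0 := by
    intro h0
    have hbot : (⊤ : Submodule ℂ (complexBetti E.X 2)) = ⊥ := by
      refine le_bot_iff.mp (hle.trans ?_)
      rw [h0, Submodule.span_zero_singleton]
    have h0' : Module.finrank ℂ (complexBetti E.X 2) = 0 := by
      rw [← finrank_top ℂ (complexBetti E.X 2), hbot, finrank_bot]
    omega
  refine ⟨vp, vm, hvp0, hvm0, hvp, hvm, hw0, fun x => ?_⟩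
  have hx : x ∈ Submodule.span ℂ {w} := hle Submodule.mem_top
  obtain ⟨κ, hκ⟩ := Submodule.mem_span_singleton.mp hx
  exact ⟨κ, hκ.symm⟩

end Curve

/-! ### The fourfold `A = (E × (E × E)) × E` and `φ_r = (r × (r × -r)) × r` -/

section Fourfold

variable (E : AbelianVariety ℂ)

/-- The surface `S = E × E`. [folklore] -/
abbrev surface : AbelianVariety ℂ := E.prod E

/-- The threefold `P = E × S`. [folklore] -/
abbrev threefold : AbelianVariety ℂ := E.prod (surface E)

/-- The fourfold `A = P × E = (E × (E × E)) × E`. [folklore] -/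
abbrev fourfold : AbelianVariety ℂ := (threefold E).prod E

variable {E}

/-- `ψ_r = r × (-r)` on `S = E × E`. [folklore] -/
def psiOf (r : E ⟶ E) : surface E ⟶ surface E :=
  AbelianVariety.prodLift (AbelianVariety.fst E E ≫ r) (AbelianVariety.snd E E ≫ (-r))

/-- `φ_P = r × ψ_r` on `P = E × S`. [folklore] -/
def phiPOf (r : E ⟶ E) : threefold E ⟶ threefold E :=
  AbelianVariety.prodLift (AbelianVariety.fst E (surface E) ≫ r) (AbelianVariety.snd E (surface E) ≫ psiOf r)

/-- **`φ_r = (r × (r × -r)) × r` on the fourfold `A`.** [folklore] -/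
def phiOf (r : E ⟶ E) : fourfold E ⟶ fourfold E :=
  AbelianVariety.prodLift (AbelianVariety.fst (threefold E) E ≫ phiPOf r) (AbelianVariety.snd (threefold E) E ≫ r)

/-- Squares of product endomorphisms: `(f × g)² = f² × g²`, componentwise. [folklore] -/
theorem prodLift_comp_prodLift_sq {X Y : AbelianVariety ℂ} (f : X ⟶ X) (g : Y ⟶ Y) :
    AbelianVariety.prodLift (AbelianVariety.fst X Y ≫ f) (AbelianVariety.snd X Y ≫ g) ≫
        AbelianVariety.prodLift (AbelianVariety.fst X Y ≫ f) (AbelianVariety.snd X Y ≫ g) =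
      AbelianVariety.prodLift (AbelianVariety.fst X Y ≫ f ≫ f) (AbelianVariety.snd X Y ≫ g ≫ g) := by
  apply AbelianVariety.prod_hom_ext
  · rw [Category.assoc, AbelianVariety.prodLift_fst, ← Category.assoc, AbelianVariety.prodLift_fst,
      AbelianVariety.prodLift_fst, Category.assoc]
  · rw [Category.assoc, AbelianVariety.prodLift_snd, ← Category.assoc, AbelianVariety.prodLift_snd,
      AbelianVariety.prodLift_snd, Category.assoc]

/-- A product endomorphism with both squares `-d` squares to `-d`. [folklore] -/
theorem prodLift_sq_eq_neg {X Y : AbelianVariety ℂ} {f : X ⟶ X} {g : Y ⟶ Y} {d : ℕ}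
    (hf : f ≫ f = -(d • 𝟙 X)) (hg : g ≫ g = -(d • 𝟙 Y)) :
    AbelianVariety.prodLift (AbelianVariety.fst X Y ≫ f) (AbelianVariety.snd X Y ≫ g) ≫
        AbelianVariety.prodLift (AbelianVariety.fst X Y ≫ f) (AbelianVariety.snd X Y ≫ g) =
      -(d • 𝟙 (X.prod Y)) := by
  rw [prodLift_comp_prodLift_sq, hf, hg]
  apply AbelianVariety.prod_hom_ext
  · rw [AbelianVariety.prodLift_fst]; simp
  · rw [AbelianVariety.prodLift_snd]; simp

/-- `(-r) ≫ (-r) = r ≫ r`. [folklore] -/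
theorem neg_comp_neg_eq {X : AbelianVariety ℂ} (r : X ⟶ X) : (-r) ≫ (-r) = r ≫ r := by
  rw [Preadditive.neg_comp, Preadditive.comp_neg, neg_neg]

variable {r : E ⟶ E} {d : ℕ} (hr : r ≫ r = -(d • 𝟙 E))
include hr

/-- `ψ_r ≫ ψ_r = -d`. [folklore] -/
theorem psiOf_comp_psiOf : psiOf r ≫ psiOf r = -(d • 𝟙 (surface E)) :=
  prodLift_sq_eq_neg hr (by rw [neg_comp_neg_eq, hr])

/-- `φ_P ≫ φ_P = -d`. [folklore] -/
theorem phiPOf_comp_phiPOf : phiPOf r ≫ phiPOf r = -(d • 𝟙 (threefold E)) :=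
  prodLift_sq_eq_neg hr (psiOf_comp_psiOf hr)

/-- **`φ_r ≫ φ_r = -d`.** [folklore] -/
theorem phiOf_comp_phiOf : phiOf r ≫ phiOf r = -(d • 𝟙 (fourfold E)) :=
  prodLift_sq_eq_neg (phiPOf_comp_phiPOf hr) hr

omit hr in
/-- Negation of a product endomorphism is componentwise. [folklore] -/
theorem neg_prodLift {X Y : AbelianVariety ℂ} (f : X ⟶ X) (g : Y ⟶ Y) :
    -AbelianVariety.prodLift (AbelianVariety.fst X Y ≫ f) (AbelianVariety.snd X Y ≫ g) =
      AbelianVariety.prodLift (AbelianVariety.fst X Y ≫ (-f)) (AbelianVariety.snd X Y ≫ (-g)) := by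
  apply AbelianVariety.prod_hom_ext
  · rw [Preadditive.neg_comp, AbelianVariety.prodLift_fst, AbelianVariety.prodLift_fst, Preadditive.comp_neg]
  · rw [Preadditive.neg_comp, AbelianVariety.prodLift_snd, AbelianVariety.prodLift_snd, Preadditive.comp_neg]

omit hr in
/-- `-ψ_r = ψ_{-r}`. [folklore] -/
theorem neg_psiOf (r : E ⟶ E) : -psiOf r = psiOf (-r) := by
  unfold psiOf; rw [neg_prodLift, neg_neg]

omit hr in
/-- `-φ_P(r) = φ_P(-r)`. [folklore] -/
theorem neg_phiPOf (r : E ⟶ E) : -phiPOf r = phiPOf (-r) := by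
  unfold phiPOf; rw [neg_prodLift, neg_psiOf]

omit hr in
/-- **`-φ_r = φ_{-r}`**: the sign of the `√-d`-structure is flipped on every factor. [folklore] -/
theorem neg_phiOf (r : E ⟶ E) : -phiOf r = phiOf (-r) := by
  unfold phiOf; rw [neg_prodLift, neg_phiPOf]

omit hr in
/-- `dim A = 4 = 2 · 2`. [folklore] -/
theorem dim_fourfold (hE : E.dim = 1) : (fourfold E).dim = 2 * 2 := by
  simp only [AbelianVariety.dim_prod, hE]

end Fourfold

/-! ### Intertwining the test endomorphisms with the projections -/

section Intertwine

variable {E : AbelianVariety ℂ} (r : E ⟶ E)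

/-- `(𝟙 + f × g) ≫ pr₁ = pr₁ ≫ (𝟙 + f)`. [folklore] -/
theorem id_add_prodLift_comp_fst {X Y : AbelianVariety ℂ} (f : X ⟶ X) (g : Y ⟶ Y) :
    (𝟙 (X.prod Y) + AbelianVariety.prodLift (AbelianVariety.fst X Y ≫ f) (AbelianVariety.snd X Y ≫ g)) ≫
        AbelianVariety.fst X Y = AbelianVariety.fst X Y ≫ (𝟙 X + f) := by
  rw [Preadditive.add_comp, Category.id_comp, AbelianVariety.prodLift_fst, Preadditive.comp_add, Category.comp_id]

/-- `(𝟙 + f × g) ≫ pr₂ = pr₂ ≫ (𝟙 + g)`. [folklore] -/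
theorem id_add_prodLift_comp_snd {X Y : AbelianVariety ℂ} (f : X ⟶ X) (g : Y ⟶ Y) :
    (𝟙 (X.prod Y) + AbelianVariety.prodLift (AbelianVariety.fst X Y ≫ f) (AbelianVariety.snd X Y ≫ g)) ≫
        AbelianVariety.snd X Y = AbelianVariety.snd X Y ≫ (𝟙 Y + g) := by
  rw [Preadditive.add_comp, Category.id_comp, AbelianVariety.prodLift_snd, Preadditive.comp_add, Category.comp_id]

/-- Transport of `(𝟙 + f × g)^*` through `pr₁^*`: `(𝟙 + f × g)^* pr₁^* y = pr₁^* (𝟙 + f)^* y`. [folklore] -/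
theorem map_id_add_prodLift_map_fst {X Y : AbelianVariety ℂ} (f : X ⟶ X) (g : Y ⟶ Y) (k : ℕ)
    (y : complexBetti X.X k) :
    complexBetti.map (𝟙 (X.prod Y) + AbelianVariety.prodLift (AbelianVariety.fst X Y ≫ f)
        (AbelianVariety.snd X Y ≫ g)).hom.hom.hom k (complexBetti.map (AbelianVariety.fst X Y).hom.hom.hom k y) =
      complexBetti.map (AbelianVariety.fst X Y).hom.hom.hom k (complexBetti.map (𝟙 X + f).hom.hom.hom k y) := by
  rw [complexBetti_map_map_hom, complexBetti_map_map_hom, id_add_prodLift_comp_fst]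

/-- Transport of `(𝟙 + f × g)^*` through `pr₂^*`: `(𝟙 + f × g)^* pr₂^* y = pr₂^* (𝟙 + g)^* y`. [folklore] -/
theorem map_id_add_prodLift_map_snd {X Y : AbelianVariety ℂ} (f : X ⟶ X) (g : Y ⟶ Y) (k : ℕ)
    (y : complexBetti Y.X k) :
    complexBetti.map (𝟙 (X.prod Y) + AbelianVariety.prodLift (AbelianVariety.fst X Y ≫ f)
        (AbelianVariety.snd X Y ≫ g)).hom.hom.hom k (complexBetti.map (AbelianVariety.snd X Y).hom.hom.hom k y) =
      complexBetti.map (AbelianVariety.snd X Y).hom.hom.hom k (complexBetti.map (𝟙 Y + g).hom.hom.hom k y) := by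
  rw [complexBetti_map_map_hom, complexBetti_map_map_hom, id_add_prodLift_comp_snd]

/-- Transport of `(f × g)^*` through `pr₁^*`: `(f × g)^* pr₁^* y = pr₁^* f^* y`. [folklore] -/
theorem map_prodLift_map_fst {X Y : AbelianVariety ℂ} (f : X ⟶ X) (g : Y ⟶ Y) (k : ℕ)
    (y : complexBetti X.X k) :
    complexBetti.map (AbelianVariety.prodLift (AbelianVariety.fst X Y ≫ f)
        (AbelianVariety.snd X Y ≫ g)).hom.hom.hom k (complexBetti.map (AbelianVariety.fst X Y).hom.hom.hom k y) =
      complexBetti.map (AbelianVariety.fst X Y).hom.hom.hom k (complexBetti.map f.hom.hom.hom k y) := by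
  rw [complexBetti_map_map_hom, complexBetti_map_map_hom, AbelianVariety.prodLift_fst]

/-- Transport of `(f × g)^*` through `pr₂^*`: `(f × g)^* pr₂^* y = pr₂^* g^* y`. [folklore] -/
theorem map_prodLift_map_snd {X Y : AbelianVariety ℂ} (f : X ⟶ X) (g : Y ⟶ Y) (k : ℕ)
    (y : complexBetti Y.X k) :
    complexBetti.map (AbelianVariety.prodLift (AbelianVariety.fst X Y ≫ f)
        (AbelianVariety.snd X Y ≫ g)).hom.hom.hom k (complexBetti.map (AbelianVariety.snd X Y).hom.hom.hom k y) =
      complexBetti.map (AbelianVariety.snd X Y).hom.hom.hom k (complexBetti.map g.hom.hom.hom k y) := by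
  rw [complexBetti_map_map_hom, complexBetti_map_map_hom, AbelianVariety.prodLift_snd]

/-- `𝟙 + (-r) = 𝟙 - r`. [folklore] -/
theorem id_add_neg_eq (r : E ⟶ E) : 𝟙 E + (-r) = 𝟙 E - r := (sub_eq_add_neg _ _).symm

end Intertwine

/-! ### The class `c` and its properties -/

section TheClass

variable {E : AbelianVariety ℂ}

local notation "𝕤" => (Complex.I * ((Real.sqrt ((3 : ℕ) : ℝ) : ℝ) : ℂ))
local notation "fS" => AbelianVariety.fst E E
local notation "sS" => AbelianVariety.snd E E
local notation "fP" => AbelianVariety.fst E (surface E)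
local notation "sP" => AbelianVariety.snd E (surface E)
local notation "fA" => AbelianVariety.fst (threefold E) E

/-- `pr₁^* x ⌣ pr₂^* y` on `X × Y` (degrees `p + q = m`). [folklore] -/
def cross {X Y : AbelianVariety ℂ} {p q m : ℕ} (h : p + q = m) (x : complexBetti X.X p) (y : complexBetti Y.X q) :
    complexBetti (X.prod Y).X m :=
  cupProduct h (complexBetti.map (AbelianVariety.fst X Y).hom.hom.hom p x)
    (complexBetti.map (AbelianVariety.snd X Y).hom.hom.hom q y)

/-- `cross` is linear in the first variable (scalars). [folklore] -/
theorem cross_smul_left {X Y : AbelianVariety ℂ} {p q m : ℕ} (h : p + q = m) (t : ℂ) (x : complexBetti X.X p)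
    (y : complexBetti Y.X q) : cross h (t • x) y = t • cross h x y := by
  simp only [cross, map_smul, LinearMap.smul_apply]

/-- `cross` is linear in the second variable (scalars). [folklore] -/
theorem cross_smul_right {X Y : AbelianVariety ℂ} {p q m : ℕ} (h : p + q = m) (t : ℂ) (x : complexBetti X.X p)
    (y : complexBetti Y.X q) : cross h x (t • y) = t • cross h x y := by
  simp only [cross, map_smul]

/-- `cross` is additive in the second variable. [folklore] -/
theorem cross_sub_right {X Y : AbelianVariety ℂ} {p q m : ℕ} (h : p + q = m) (x : complexBetti X.X p)
    (y y' : complexBetti Y.X q) : cross h x (y - y') = cross h x y - cross h x y' := by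
  simp only [cross, map_sub]

/-- `(𝟙 + f × g)^*` acts on `pr₁^* x ⌣ pr₂^* y` factorwise. [cite: HatcherAT2002, Prop. 3.10] -/
theorem map_id_add_prodLift_cross {X Y : AbelianVariety ℂ} (f : X ⟶ X) (g : Y ⟶ Y) {p q m : ℕ}
    (h : p + q = m) (x : complexBetti X.X p) (y : complexBetti Y.X q) :
    complexBetti.map (𝟙 (X.prod Y) + AbelianVariety.prodLift (AbelianVariety.fst X Y ≫ f)
        (AbelianVariety.snd X Y ≫ g)).hom.hom.hom m (cross h x y) =
      cross h (complexBetti.map (𝟙 X + f).hom.hom.hom p x) (complexBetti.map (𝟙 Y + g).hom.hom.hom q y) := by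
  rw [cross, map_cupProduct, map_id_add_prodLift_map_fst, map_id_add_prodLift_map_snd, cross]

/-- `(f × g)^*` acts on `pr₁^* x ⌣ pr₂^* y` factorwise. [cite: HatcherAT2002, Prop. 3.10] -/
theorem map_prodLift_cross {X Y : AbelianVariety ℂ} (f : X ⟶ X) (g : Y ⟶ Y) {p q m : ℕ}
    (h : p + q = m) (x : complexBetti X.X p) (y : complexBetti Y.X q) :
    complexBetti.map (AbelianVariety.prodLift (AbelianVariety.fst X Y ≫ f) (AbelianVariety.snd X Y ≫ g)).hom.hom.hom m
        (cross h x y) =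
      cross h (complexBetti.map f.hom.hom.hom p x) (complexBetti.map g.hom.hom.hom q y) := by
  rw [cross, map_cupProduct, map_prodLift_map_fst, map_prodLift_map_snd, cross]

/-- **Künneth non-vanishing** `pr₁^* x ⌣ pr₂^* y ≠ 0` for `x ≠ 0`, `y ≠ 0` (degrees `p + q`, `q ≤ 2 dim Y`).
[cite: HatcherAT2002, Thm. 3.15] -/
theorem cross_ne_zero {X Y : AbelianVariety ℂ} {mX mY : ℕ} (hX : X.dim = mX) (hY : Y.dim = mY)
    {p q m : ℕ} (h : p + q = m) (hq : q ≤ 2 * mY) {x : complexBetti X.X p} {y : complexBetti Y.X q}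
    (hx : x ≠ 0) (hy : y ≠ 0) : cross h x y ≠ 0 := by
  have hqm : q ≤ m := by omega
  have hp : m - q = p := by omega
  subst hp
  exact cupProduct_map_fst_map_snd_ne_zero (isSmoothProjective_of_dim_eq' hX) (isSmoothProjective_of_dim_eq' hY)
    hqm hq hx hy

/-- `pr₁^*` is injective (the section `(𝟙, 0)` splits it). [folklore] -/
theorem map_fst_injective {X Y : AbelianVariety ℂ} (k : ℕ) :
    Function.Injective (complexBetti.map (AbelianVariety.fst X Y).hom.hom.hom k) := by
  intro a b hab
  have h := congrArg (complexBetti.map (AbelianVariety.prodLift (𝟙 X) (0 : X ⟶ Y)).hom.hom.hom k) hab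
  rwa [complexBetti_map_map_hom, complexBetti_map_map_hom, AbelianVariety.prodLift_fst,
    show complexBetti.map ((𝟙 X : X ⟶ X)).hom.hom.hom k = 𝟙 _ from complexBetti.map_id k,
    CategoryTheory.id_apply, CategoryTheory.id_apply] at h

/-- **The descent class** `δ(π) = m^*π - pr₁^*π - pr₂^*π ∈ H²((E × E)(ℂ); ℂ)` (`m = pr₁ + pr₂`).
[cite: LangeBirkenhake1992, Lemma 1.1.17] -/
def deltaClass (π : complexBetti E.X 2) : complexBetti (surface E).X 2 :=
  complexBetti.map (fS + sS).hom.hom.hom 2 π - complexBetti.map (fS).hom.hom.hom 2 π -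
    complexBetti.map (sS).hom.hom.hom 2 π

/-- The class `pr₁^*π ⌣ pr₂^*δ(π) ∈ H⁴((E × (E × E))(ℂ); ℂ)`. [folklore] -/
def threefoldClass (π : complexBetti E.X 2) : complexBetti (threefold E).X 4 :=
  cross (show 2 + 2 = 4 from rfl) π (deltaClass π)

/-- **The counterexample class** `c(π) = pr_{123}^*(pr₁^*π ⌣ pr₂^*δ(π)) ∈ H⁴(A(ℂ); ℂ)`. [folklore] -/
def fourfoldClass (π : complexBetti E.X 2) : complexBetti (fourfold E).X 4 :=
  complexBetti.map (fA).hom.hom.hom 4 (threefoldClass π)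

/-- **`δ(κ·v₊ ⌣ v₋) = κ·(pr₁^*v₊ ⌣ pr₂^*v₋ - pr₁^*v₋ ⌣ pr₂^*v₊)`** (`m^* = pr₁^* + pr₂^*` on `H¹`,
multiplicativity, `v ⌣ v' = -v' ⌣ v` in degree one). [cite: LangeBirkenhake1992, Lemma 1.1.17] -/
theorem deltaClass_eq (vp vm : complexBetti E.X 1) (κ : ℂ) :
    deltaClass (κ • cupProduct (rfl : 1 + 1 = 2) vp vm) =
      κ • (cross (rfl : 1 + 1 = 2) vp vm - cross (rfl : 1 + 1 = 2) vm vp) := by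
  have hm : complexBetti.map (fS + sS).hom.hom.hom 2 (cupProduct (rfl : 1 + 1 = 2) vp vm) =
      complexBetti.map (fS).hom.hom.hom 2 (cupProduct (rfl : 1 + 1 = 2) vp vm) + cross (rfl : 1 + 1 = 2) vp vm +
        (cupProduct (rfl : 1 + 1 = 2) (complexBetti.map (sS).hom.hom.hom 1 vp) (complexBetti.map (fS).hom.hom.hom 1 vm) +
          complexBetti.map (sS).hom.hom.hom 2 (cupProduct (rfl : 1 + 1 = 2) vp vm)) := by
    rw [map_cupProduct, complexBetti_map_add_deg_one, complexBetti_map_add_deg_one, map_cupProduct (fS),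
      map_cupProduct (sS)]
    simp only [map_add, LinearMap.add_apply, cross]
    abel
  have hanti : cupProduct (rfl : 1 + 1 = 2) (complexBetti.map (sS).hom.hom.hom 1 vp)
      (complexBetti.map (fS).hom.hom.hom 1 vm) = -cross (rfl : 1 + 1 = 2) vm vp := by
    have h := cupProduct_gradedComm_holds ℂ (ComplexPoints (surface E).X) (rfl : 1 + 1 = 2) rfl
      (complexBetti.map (sS).hom.hom.hom 1 vp) (complexBetti.map (fS).hom.hom.hom 1 vm)
    simp only [mul_one, pow_one, neg_smul, one_smul] at h
    exact h
  rw [deltaClass, map_smul, map_smul, map_smul, hm, hanti]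
  simp only [smul_add, smul_neg, smul_sub]
  abel

/-- **`pr₁^*v₊ ⌣ pr₂^*v₋ - pr₁^*v₋ ⌣ pr₂^*v₊ ≠ 0`** for non-zero `v± ∈ Eig(r^*, ± i√3)`: the endomorphism
`(r × 𝟙)^*` acts on the two products by `± i√3`, and each is non-zero (Künneth). [cite: HatcherAT2002, Thm. 3.15] -/
theorem cross_sub_cross_ne_zero (hE : E.dim = 1) {r : E ⟶ E} {vp vm : complexBetti E.X 1} (hvp0 : vp ≠ 0)
    (hvm0 : vm ≠ 0) (hvp : vp ∈ Module.End.eigenspace (complexBetti.map r.hom.hom.hom 1).hom 𝕤)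
    (hvm : vm ∈ Module.End.eigenspace (complexBetti.map r.hom.hom.hom 1).hom (-𝕤)) :
    cross (rfl : 1 + 1 = 2) vp vm - cross (rfl : 1 + 1 = 2) vm vp ≠ 0 := by
  have ht₁0 : cross (rfl : 1 + 1 = 2) vp vm ≠ 0 := cross_ne_zero hE hE (rfl : 1 + 1 = 2) (by norm_num) hvp0 hvm0
  have hθ₁ : complexBetti.map (AbelianVariety.prodLift ((fS) ≫ r) ((sS) ≫ 𝟙 E)).hom.hom.hom 2
      (cross (rfl : 1 + 1 = 2) vp vm) = 𝕤 • cross (rfl : 1 + 1 = 2) vp vm := by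
    rw [map_prodLift_cross]
    change cross _ ((complexBetti.map r.hom.hom.hom 1).hom vp) (complexBetti.map (𝟙 E.X) 1 vm) = _
    rw [Module.End.mem_eigenspace_iff.mp hvp, complexBetti.map_id, CategoryTheory.id_apply, cross_smul_left]
  have hθ₂ : complexBetti.map (AbelianVariety.prodLift ((fS) ≫ r) ((sS) ≫ 𝟙 E)).hom.hom.hom 2
      (cross (rfl : 1 + 1 = 2) vm vp) = (-𝕤) • cross (rfl : 1 + 1 = 2) vm vp := by
    rw [map_prodLift_cross]
    change cross _ ((complexBetti.map r.hom.hom.hom 1).hom vm) (complexBetti.map (𝟙 E.X) 1 vp) = _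
    rw [Module.End.mem_eigenspace_iff.mp hvm, complexBetti.map_id, CategoryTheory.id_apply, cross_smul_left]
  intro h0
  have hsum : cross (rfl : 1 + 1 = 2) vp vm + cross (rfl : 1 + 1 = 2) vm vp = 0 := by
    have h := congrArg (complexBetti.map (AbelianVariety.prodLift ((fS) ≫ r) ((sS) ≫ 𝟙 E)).hom.hom.hom 2) h0
    rw [map_sub, hθ₁, hθ₂, map_zero, neg_smul, sub_neg_eq_add, ← smul_add, smul_eq_zero] at h
    exact h.resolve_left (I_mul_sqrt_ne_zero (by norm_num))
  have h2 : (2 : ℂ) • cross (rfl : 1 + 1 = 2) vp vm = 0 := by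
    rw [two_smul]
    nth_rewrite 2 [show cross (rfl : 1 + 1 = 2) vp vm = cross (rfl : 1 + 1 = 2) vm vp from sub_eq_zero.mp h0]
    exact hsum
  exact ht₁0 ((smul_eq_zero.mp h2).resolve_left two_ne_zero)

/-- `c(π)` is rational for `π` rational (pull-backs, differences and cup products of rational classes).
[cite: HatcherAT2002, §3.1 and §3.2] -/
theorem isRationalClass_fourfoldClass {π : complexBetti E.X 2} (hπ : IsRationalClass π) :
    IsRationalClass (fourfoldClass π) := by
  have hδ : IsRationalClass (deltaClass π) :=
    isRationalClass_sub (isRationalClass_sub (isRationalClass_map _ hπ) (isRationalClass_map _ hπ))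
      (isRationalClass_map _ hπ)
  exact isRationalClass_map _ ((isRationalClass_map _ hπ).cup _ (isRationalClass_map _ hδ))

/-- `δ(π)` is of Hodge type `(1, 1)`: `π` is (top degree on the curve `E`) and pull-backs preserve
types (`preservesHodgeType_of_nonempty_hodgeModel`). [cite: VoisinHodgeI2002, §7.3.2 and Cor. 6.14] -/
theorem isOfHodgeType_deltaClass (hE : E.dim = 1) (π : complexBetti E.X 2) :
    IsOfHodgeType 2 (surface E).X 2 1 1 (deltaClass π) := by
  have hE1 : IsSmoothProjective 1 E.X := isSmoothProjective_of_dim_eq' hE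
  have hS2 : IsSmoothProjective 2 (surface E).X :=
    isSmoothProjective_of_dim_eq' (by simp only [AbelianVariety.dim_prod, hE])
  have hI := hodgePQ_independent_of_hodgeModel_holds
  have hπH : IsOfHodgeType 1 E.X 2 1 1 π :=
    isOfHodgeType_top (nonempty_hodgeModel_holds.nonempty hE1).some π
  have hfSH : PreservesHodgeType 2 1 (fS).hom.hom.hom :=
    preservesHodgeType_of_nonempty_hodgeModel hI nonempty_hodgeModel_holds hS2 hE1 _
  have hsSH : PreservesHodgeType 2 1 (sS).hom.hom.hom :=
    preservesHodgeType_of_nonempty_hodgeModel hI nonempty_hodgeModel_holds hS2 hE1 _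
  have hmSH : PreservesHodgeType 2 1 (fS + sS).hom.hom.hom :=
    preservesHodgeType_of_nonempty_hodgeModel hI nonempty_hodgeModel_holds hS2 hE1 _
  have h1 : IsOfHodgeType 2 (surface E).X 2 1 1 (complexBetti.map (fS + sS).hom.hom.hom 2 π) := hmSH hπH
  have h2 : IsOfHodgeType 2 (surface E).X 2 1 1 (complexBetti.map (fS).hom.hom.hom 2 π) := hfSH hπH
  have h3 : IsOfHodgeType 2 (surface E).X 2 1 1 (complexBetti.map (sS).hom.hom.hom 2 π) := hsSH hπH
  have h4 := (h1.sub hS2 h2).sub hS2 h3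
  rw [deltaClass]
  exact h4

/-- `pr₁^*π ⌣ pr₂^*δ(π)` is of Hodge type `(2, 2)` (pull-backs preserve types, the cup product adds
them: `cupPreservesHodgeType_of_nonempty_hodgeModel` with de Rham's theorem).
[cite: VoisinHodgeI2002, §7.3.2, §7.1.2] -/
theorem isOfHodgeType_threefoldClass (hE : E.dim = 1) (π : complexBetti E.X 2) :
    IsOfHodgeType 3 (threefold E).X 4 2 2 (threefoldClass π) := by
  have hE1 : IsSmoothProjective 1 E.X := isSmoothProjective_of_dim_eq' hE
  have hS2 : IsSmoothProjective 2 (surface E).X :=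
    isSmoothProjective_of_dim_eq' (by simp only [AbelianVariety.dim_prod, hE])
  have hP3 : IsSmoothProjective 3 (threefold E).X :=
    isSmoothProjective_of_dim_eq' (by simp only [AbelianVariety.dim_prod, hE])
  have hI := hodgePQ_independent_of_hodgeModel_holds
  have hπH : IsOfHodgeType 1 E.X 2 1 1 π :=
    isOfHodgeType_top (nonempty_hodgeModel_holds.nonempty hE1).some π
  have hfPH : PreservesHodgeType 3 1 (fP).hom.hom.hom :=
    preservesHodgeType_of_nonempty_hodgeModel hI nonempty_hodgeModel_holds hP3 hE1 _
  have hsPH : PreservesHodgeType 3 2 (sP).hom.hom.hom :=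
    preservesHodgeType_of_nonempty_hodgeModel hI nonempty_hodgeModel_holds hP3 hS2 _
  have hcupP : CupPreservesHodgeType 3 (threefold E).X :=
    cupPreservesHodgeType_of_nonempty_hodgeModel hI nonempty_hodgeModel_holds
      (fun F _ _ _ ↦ Literature.NumberTheory.Transcendental.exists_deRhamIsoFamily_holds F) hP3
  have h1 : IsOfHodgeType 3 (threefold E).X 2 1 1 (complexBetti.map (fP).hom.hom.hom 2 π) := hfPH hπH
  have h2 : IsOfHodgeType 3 (threefold E).X 2 1 1 (complexBetti.map (sP).hom.hom.hom 2 (deltaClass π)) :=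
    hsPH (isOfHodgeType_deltaClass hE π)
  have h3 : IsOfHodgeType 3 (threefold E).X 4 (1 + 1) (1 + 1) (cupProduct (show 2 + 2 = 4 from rfl)
      (complexBetti.map (fP).hom.hom.hom 2 π) (complexBetti.map (sP).hom.hom.hom 2 (deltaClass π))) :=
    hcupP (show 2 + 2 = 4 from rfl) h1 h2
  rw [threefoldClass, cross]
  exact h3

/-- **`c(π)` is of Hodge type `(2, 2)`** (`pr^*` preserves types). [cite: VoisinHodgeI2002, §7.3.2] -/
theorem isOfHodgeType_fourfoldClass (hE : E.dim = 1) (π : complexBetti E.X 2) :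
    IsOfHodgeType 4 (fourfold E).X 4 2 2 (fourfoldClass π) := by
  have hP3 : IsSmoothProjective 3 (threefold E).X :=
    isSmoothProjective_of_dim_eq' (by simp only [AbelianVariety.dim_prod, hE])
  have hA4 : IsSmoothProjective 4 (fourfold E).X :=
    isSmoothProjective_of_dim_eq' (by simp only [AbelianVariety.dim_prod, hE])
  have hI := hodgePQ_independent_of_hodgeModel_holds
  have hfAH : PreservesHodgeType 4 3 (fA).hom.hom.hom :=
    preservesHodgeType_of_nonempty_hodgeModel hI nonempty_hodgeModel_holds hA4 hP3 _
  have h1 : IsOfHodgeType 4 (fourfold E).X 4 2 2 (complexBetti.map (fA).hom.hom.hom 4 (threefoldClass π)) :=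
    hfAH (isOfHodgeType_threefoldClass hE π)
  rw [fourfoldClass]
  exact h1

/-- **The test endomorphism on the building blocks of `c`**: for `y ∈ H²(E × E)`,
`(𝟙 + φ_r)^* pr^*(pr₁^*π ⌣ pr₂^*y) = pr^*(pr₁^*(𝟙 + r)^*π ⌣ pr₂^*(𝟙 + ψ_r)^*y)`. [cite: HatcherAT2002, Prop. 3.10] -/
theorem map_id_add_phiOf_fourfoldCross (r : E ⟶ E) (π : complexBetti E.X 2) (y : complexBetti (surface E).X 2) :
    complexBetti.map (𝟙 (fourfold E) + phiOf r).hom.hom.hom 4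
        (complexBetti.map (fA).hom.hom.hom 4 (cross (show 2 + 2 = 4 from rfl) π y)) =
      complexBetti.map (fA).hom.hom.hom 4 (cross (show 2 + 2 = 4 from rfl)
        (complexBetti.map (𝟙 E + r).hom.hom.hom 2 π) (complexBetti.map (𝟙 (surface E) + psiOf r).hom.hom.hom 2 y)) := by
  rw [phiOf, map_id_add_prodLift_map_fst, phiPOf, map_id_add_prodLift_cross]

/-- `(𝟙 + r)^*(v₊ ⌣ v₋) = (1 + i√3)(1 - i√3)·(v₊ ⌣ v₋) = 4 (v₊ ⌣ v₋)`. [cite: LangeBirkenhake1992, §1.1 p. 19] -/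
theorem map_id_add_cupProduct_eigen {r : E ⟶ E} {vp vm : complexBetti E.X 1}
    (hvp : vp ∈ Module.End.eigenspace (complexBetti.map r.hom.hom.hom 1).hom 𝕤)
    (hvm : vm ∈ Module.End.eigenspace (complexBetti.map r.hom.hom.hom 1).hom (-𝕤)) :
    complexBetti.map (𝟙 E + r).hom.hom.hom 2 (cupProduct (rfl : 1 + 1 = 2) vp vm) =
      (4 : ℂ) • cupProduct (rfl : 1 + 1 = 2) vp vm := by
  have hs2 : 𝕤 * 𝕤 = -3 := by
    have h := I_mul_sqrt_sq 3; rw [sq] at h; rw [h]; norm_num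
  rw [map_cupProduct, map_id_add_one_of_mem_eigenspace hvp, map_id_add_one_of_mem_eigenspace hvm]
  simp only [map_smul, LinearMap.smul_apply, smul_smul]
  congr 1
  linear_combination (-1 : ℂ) * hs2

/-- `(𝟙 + ψ_r)^*(pr₁^*v ⌣ pr₂^*v') = (1 + μ)(1 - μ')·(pr₁^*v ⌣ pr₂^*v')` for eigenvectors `v`, `v'`
of `r^*` with eigenvalues `μ`, `μ'` (`ψ_r = r × (-r)`). [cite: LangeBirkenhake1992, §1.1 p. 19] -/
theorem map_id_add_psiOf_cross {r : E ⟶ E} {μ μ' : ℂ} {v v' : complexBetti E.X 1}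
    (hv : v ∈ Module.End.eigenspace (complexBetti.map r.hom.hom.hom 1).hom μ)
    (hv' : v' ∈ Module.End.eigenspace (complexBetti.map r.hom.hom.hom 1).hom μ') :
    complexBetti.map (𝟙 (surface E) + psiOf r).hom.hom.hom 2 (cross (rfl : 1 + 1 = 2) v v') =
      ((1 + μ) * (1 - μ')) • cross (rfl : 1 + 1 = 2) v v' := by
  rw [psiOf, map_id_add_prodLift_cross, map_id_add_one_of_mem_eigenspace hv, id_add_neg_eq,
    map_id_sub_one_of_mem_eigenspace hv', cross_smul_left, cross_smul_right, smul_smul]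

variable (hE : E.dim = 1) {r : E ⟶ E} (hr : r ≫ r = -((3 : ℕ) • 𝟙 E))
include hE hr

/-- **The counterexample class.** For an elliptic curve `(E, r)` with `r ≫ r = -3` there is a class
`c ∈ H⁴(A(ℂ); ℂ)` on the fourfold `A = (E × (E × E)) × E` with `φ_r = (r × (r × -r)) × r` which is
NON-ZERO, RATIONAL, of HODGE TYPE `(2, 2)`, and lies in the single-test "Weil span"
`Eig((𝟙 + φ_r)^*, (1 + i√3)⁴) ⊔ Eig((𝟙 + φ_r)^*, (1 - i√3)⁴)` — although `(A, φ_r)` has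
`K`-multiplicities `(3, 1)` or `(1, 3)` and hence NO Weil classes: `c = pr^*(pr₁^*π ⌣ pr₂^*δ)` with
`π ∈ H²(E)` rational non-zero and `δ = m^*π - pr₁^*π - pr₂^*π = κ(pr₁^*v₊ ⌣ pr₂^*v₋ - pr₁^*v₋ ⌣ pr₂^*v₊)`,
on whose two halves `(𝟙 + φ_r)^*` acts by `4(1 + i√3)² = (1 - i√3)⁴` and `4(1 - i√3)² = (1 + i√3)⁴`
(the collision `(1+i√3)(1-i√3)³ = (1+i√3)⁴`, `Motives/AimedSplitProduct`).
[cite: vanGeemen1994HodgeAV, Lemma 5.2 (6) and its proof] -/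
theorem exists_singleTest_weilSpan_class :
    ∃ c : complexBetti (fourfold E).X (2 * 2), c ≠ 0 ∧ IsRationalClass c ∧
      IsOfHodgeType (2 * 2) (fourfold E).X (2 * 2) 2 2 c ∧
      c ∈ Module.End.eigenspace (complexBetti.map (𝟙 (fourfold E) + phiOf r).hom.hom.hom (2 * 2)).hom
            ((1 + Complex.I * (Real.sqrt ((3 : ℕ) : ℝ) : ℂ)) ^ (2 * 2)) ⊔
          Module.End.eigenspace (complexBetti.map (𝟙 (fourfold E) + phiOf r).hom.hom.hom (2 * 2)).hom
            ((1 - Complex.I * (Real.sqrt ((3 : ℕ) : ℝ) : ℂ)) ^ (2 * 2)) := by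
  -- eigenvectors and the top class `w = v₊ ⌣ v₋` of `E`; a rational `π = κ₀ w ≠ 0`
  obtain ⟨vp, vm, hvp0, hvm0, hvp, hvm, hw0, hspan2⟩ := exists_eigenvectors_two hE hr
  have hEsp : IsSmoothProjective (0 + 1) E.X := isSmoothProjective_of_dim_eq' (by rw [hE])
  obtain ⟨π, hπrat, hπ0⟩ := exists_isRationalClass_ne_zero_two_add_two_mul hEsp
  change complexBetti E.X 2 at π
  obtain ⟨κ₀, hπ⟩ := hspan2 π
  have hκ₀ : κ₀ ≠ 0 := by rintro rfl; exact hπ0 (by rw [hπ, zero_smul])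
  have hSdim : (surface E).dim = 2 := by simp only [AbelianVariety.dim_prod, hE]
  -- `δ(π) = κ₀ (t₁ - t₂)` with `t₁ = pr₁^*v₊ ⌣ pr₂^*v₋`, `t₂ = pr₁^*v₋ ⌣ pr₂^*v₊`
  have hδ : deltaClass π = κ₀ • (cross (rfl : 1 + 1 = 2) vp vm - cross (rfl : 1 + 1 = 2) vm vp) := by
    rw [hπ, deltaClass_eq]
  refine ⟨fourfoldClass π, ?_, isRationalClass_fourfoldClass hπrat, isOfHodgeType_fourfoldClass hE π, ?_⟩
  · -- `c ≠ 0`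
    have hδ0 : deltaClass π ≠ 0 := by
      rw [hδ, smul_ne_zero_iff]
      exact ⟨hκ₀, cross_sub_cross_ne_zero hE hvp0 hvm0 hvp hvm⟩
    have hcP0 : threefoldClass π ≠ 0 := cross_ne_zero hE hSdim (show 2 + 2 = 4 from rfl) (by norm_num) hπ0 hδ0
    intro h0
    exact hcP0 (map_fst_injective (X := threefold E) (Y := E) 4 (by rw [map_zero]; exact h0))
  · -- the single-test Weil span: eigenvalues `4(1 ± i√3)² = (1 ∓ i√3)⁴` on the two halves of `c`
    have hrπ : complexBetti.map (𝟙 E + r).hom.hom.hom 2 π = (4 : ℂ) • π := by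
      rw [hπ, map_smul, map_id_add_cupProduct_eigen hvp hvm, smul_comm]
    have hψt₁ := map_id_add_psiOf_cross (r := r) hvp hvm
    have hψt₂ := map_id_add_psiOf_cross (r := r) hvm hvp
    rw [sub_neg_eq_add, ← sq] at hψt₁
    rw [← sub_eq_add_neg, ← sq] at hψt₂
    -- the two halves
    have hc : fourfoldClass π =
        κ₀ • complexBetti.map (fA).hom.hom.hom 4 (cross (show 2 + 2 = 4 from rfl) π (cross (rfl : 1 + 1 = 2) vp vm)) -
          κ₀ • complexBetti.map (fA).hom.hom.hom 4 (cross (show 2 + 2 = 4 from rfl) π (cross (rfl : 1 + 1 = 2) vm vp)) := by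
      rw [fourfoldClass, threefoldClass, hδ, cross_smul_right, cross_sub_right, map_smul, map_sub, smul_sub]
    have he₁ : complexBetti.map (𝟙 (fourfold E) + phiOf r).hom.hom.hom 4
        (complexBetti.map (fA).hom.hom.hom 4 (cross (show 2 + 2 = 4 from rfl) π (cross (rfl : 1 + 1 = 2) vp vm))) =
        ((1 - 𝕤) ^ 4) • complexBetti.map (fA).hom.hom.hom 4
          (cross (show 2 + 2 = 4 from rfl) π (cross (rfl : 1 + 1 = 2) vp vm)) := by
      rw [map_id_add_phiOf_fourfoldCross, hrπ, hψt₁, cross_smul_left, cross_smul_right, smul_smul, map_smul,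
        four_mul_one_add_sq]
    have he₂ : complexBetti.map (𝟙 (fourfold E) + phiOf r).hom.hom.hom 4
        (complexBetti.map (fA).hom.hom.hom 4 (cross (show 2 + 2 = 4 from rfl) π (cross (rfl : 1 + 1 = 2) vm vp))) =
        ((1 + 𝕤) ^ 4) • complexBetti.map (fA).hom.hom.hom 4
          (cross (show 2 + 2 = 4 from rfl) π (cross (rfl : 1 + 1 = 2) vm vp)) := by
      rw [map_id_add_phiOf_fourfoldCross, hrπ, hψt₂, cross_smul_left, cross_smul_right, smul_smul, map_smul,
        four_mul_one_sub_sq]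
    change fourfoldClass π ∈
      Module.End.eigenspace (complexBetti.map (𝟙 (fourfold E) + phiOf r).hom.hom.hom 4).hom ((1 + 𝕤) ^ 4) ⊔
        Module.End.eigenspace (complexBetti.map (𝟙 (fourfold E) + phiOf r).hom.hom.hom 4).hom ((1 - 𝕤) ^ 4)
    rw [hc]
    exact Submodule.sub_mem _ (Submodule.smul_mem _ _ (Submodule.mem_sup_right (Module.End.mem_eigenspace_iff.mpr he₁)))
      (Submodule.smul_mem _ _ (Submodule.mem_sup_left (Module.End.mem_eigenspace_iff.mpr he₂)))

end TheClass

end EisensteinCounterexample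

end Literature.AlgebraicGeometry.Motives

end
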